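import Summits.Ventures.HodgeRepro2.T6N3SideRich
import Summits.Ventures.HodgeRepro2.T6N3Assembly

/-!
# T6N3DatumRich — STAGE 0 of the host `d3`, the datum: both sides rich, and the N3 statements over it

Cell pub-hodge-repro2, Tier 6 (README §10), seat t6-p3 (N3 owner). FILED in WAVE 1 (p437821, row 3d-2;
TARGET-T6.md v1.5 §11.0 decision (7); route/T6-N3-t6-p3.md v0.27 / v0.30 / v0.34); v2 = a DOCSTRING-ONLY
successor version (this header sentence only; kernel content unchanged; count NONE); proof lane over the
definition `N3DatumRich` (count-neutral: the statements
of T6N3Assembly re-read over `toDatum`, four interface binders per side DISCHARGED by the construction of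
T6N3SideRich — `KliftCont`, `Adjoint`, `CopiesOrthogonal`, `TensorsSpan` — the rest unchanged).

`N3A_of_datumRich` / `N3B_of_datumRich` are `N3A_of_datum` / `N3B_of_datum` (T6N3Assembly) on
`R.toDatum` with the four discharged binders supplied by `N3SideRich.toSide_*`: 20 → 16 explicit
interface binders per side. `N3iso_of_datumRich` is `N3iso_of_datum` on `R.toDatum` (the Rogawski-side
binders are untouched by STAGE 0).

§8(d): uses an L-value-free non-vanishing device: NO.
-/

namespace Summit.Ventures.HodgeRepro2.T6

open scoped InnerProductSpace

/-- THE RICH DATUM OF N3: the shared G-side of `N3Datum` (T6N3Datum) with both sides rich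
(`N3SideRich`, T6N3SideRich). Every field is an object; no field is a theorem. -/
structure N3DatumRich where
  /-- `L²([G])` -/
  LG : Type
  [instNormedAddCommGroupLG : NormedAddCommGroup LG]
  [instInnerProductSpaceLG : InnerProductSpace ℂ LG]
  [instCompleteSpaceLG : CompleteSpace LG]
  /-- `G(𝔸_f)` -/
  Gf : Type
  [instGroupGf : Group Gf]
  /-- right translation on `L²([G])` -/
  ρ : Gf → LG →ₗᵢ[ℂ] LG
  /-- the `τ`-isotypic vectors of `L²([G])` -/
  τiso : Submodule ℂ LG
  /-- the index set of the τ-type automorphic subrepresentations -/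
  Aut : Type
  /-- the τ-type automorphic subrepresentations of `L²([G])` -/
  aut : Aut → Submodule ℂ LG
  /-- side A, rich -/
  A : N3SideRich LG Gf
  /-- side B, rich -/
  B : N3SideRich LG Gf

namespace N3DatumRich

variable (R : N3DatumRich)

/-- the normed group structure of `L²([G])` (field) -/
instance : NormedAddCommGroup R.LG := R.instNormedAddCommGroupLG
/-- the inner product of `L²([G])` (field) -/
instance : InnerProductSpace ℂ R.LG := R.instInnerProductSpaceLG
/-- `L²([G])` is complete (field) -/
instance : CompleteSpace R.LG := R.instCompleteSpaceLG
/-- the group structure of `G(𝔸_f)` (field) -/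
instance : Group R.Gf := R.instGroupGf

/-- THE FORGETFUL BRIDGE to the datum of record (T6N3Datum): both sides through `N3SideRich.toSide` (an
`abbrev`, so that the fields of `R.toDatum` reduce to those of `R`). -/
noncomputable abbrev toDatum : N3Datum where
  LG := R.LG
  Gf := R.Gf
  ρ := R.ρ
  τiso := R.τiso
  Aut := R.Aut
  aut := R.aut
  A := R.A.toSide
  B := R.B.toSide

/-- `toDatum.A = A.toSide`. -/
@[simp] theorem toDatum_A : R.toDatum.A = R.A.toSide := rfl

/-- `toDatum.B = B.toSide`. -/
@[simp] theorem toDatum_B : R.toDatum.B = R.B.toSide := rfl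

/-- N3A over the rich datum: `N3A_of_datum` with `KliftCont`, `Adjoint`, `CopiesOrthogonal`, `TensorsSpan`
discharged by construction — 16 explicit interface binders on side A. -/
theorem N3A_of_datumRich (hSeam : R.toDatum.A.Seam R.A.toSide_kliftCont)
    (hKL : R.toDatum.A.KliftLevel) (hKI : R.toDatum.A.KliftIsotypic)
    (hΘσ : R.toDatum.A.ThetaMemSigma) (hΘτ : R.toDatum.A.ThetaTauType R.toDatum.τiso)
    (hE : R.toDatum.A.CopiesEquivariant) (hIncl : R.toDatum.A.CopiesIncl)
    (hTau : R.toDatum.A.CopiesTauType) (hDec : R.toDatum.A.TauTypeDecomposes)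
    (hF : R.toDatum.A.LevelPartFinite) (hC : R.toDatum.A.LevelPartCont)
    (hAvg : R.toDatum.A.KAverage) (hEq : R.toDatum.A.ThetaEquivariant)
    (hSpan : R.toDatum.A.SpanOfFixedVector) (hCO : R.toDatum.A.CrossCopyOrthogonal)
    (hInd : R.toDatum.A.CopyIndependence) :
    R.toDatum.A.hypI → R.toDatum.A.hypII → R.toDatum.ellNonzero R.toDatum.A :=
  R.toDatum.N3A_of_datum R.A.toSide_kliftCont hSeam R.A.toSide_adjoint hKL hKI hΘσ hΘτ hE
    R.A.toSide_copiesOrthogonal hIncl hTau hDec hF hC hAvg hEq hSpan hCO hInd R.A.toSide_tensorsSpan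

/-- N3B over the rich datum: the same on side B. -/
theorem N3B_of_datumRich (hSeam : R.toDatum.B.Seam R.B.toSide_kliftCont)
    (hKL : R.toDatum.B.KliftLevel) (hKI : R.toDatum.B.KliftIsotypic)
    (hΘσ : R.toDatum.B.ThetaMemSigma) (hΘτ : R.toDatum.B.ThetaTauType R.toDatum.τiso)
    (hE : R.toDatum.B.CopiesEquivariant) (hIncl : R.toDatum.B.CopiesIncl)
    (hTau : R.toDatum.B.CopiesTauType) (hDec : R.toDatum.B.TauTypeDecomposes)
    (hF : R.toDatum.B.LevelPartFinite) (hC : R.toDatum.B.LevelPartCont)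
    (hAvg : R.toDatum.B.KAverage) (hEq : R.toDatum.B.ThetaEquivariant)
    (hSpan : R.toDatum.B.SpanOfFixedVector) (hCO : R.toDatum.B.CrossCopyOrthogonal)
    (hInd : R.toDatum.B.CopyIndependence) :
    R.toDatum.B.hypI → R.toDatum.B.hypII → R.toDatum.ellNonzero R.toDatum.B :=
  R.toDatum.N3B_of_datum R.B.toSide_kliftCont hSeam R.B.toSide_adjoint hKL hKI hΘσ hΘτ hE
    R.B.toSide_copiesOrthogonal hIncl hTau hDec hF hC hAvg hEq hSpan hCO hInd R.B.toSide_tensorsSpan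

/-- N3iso over the rich datum: `N3iso_of_datum` on `toDatum` (the Rogawski side is untouched by STAGE 0). -/
theorem N3iso_of_datumRich (hO : R.toDatum.AutOrthogonal) (hst : R.toDatum.AutStable)
    (hsimp : R.toDatum.AutSimple) (hnon : R.toDatum.AutNonIso hst)
    (hPX : R.toDatum.ProductsIn20 R.toDatum.A) (hPeqX : R.toDatum.ProductEquivariant R.toDatum.A)
    (hPY : R.toDatum.ProductsIn20 R.toDatum.B) (hPeqY : R.toDatum.ProductEquivariant R.toDatum.B)
    (hσX : R.toDatum.SigmaIsAut R.toDatum.A) (hσ : R.toDatum.B.σ = R.toDatum.A.σ) :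
    R.toDatum.ellNonzero R.toDatum.A → R.toDatum.ellNonzero R.toDatum.B →
      ∃ (φa : R.toDatum.A.Sa) (φb : R.toDatum.A.Sb) (φc : R.toDatum.B.Sa) (φd : R.toDatum.B.Sb),
        ⟪R.toDatum.B.F φc φd, R.toDatum.A.F φa φb⟫_ℂ ≠ 0 :=
  R.toDatum.N3iso_of_datum hO hst hsimp hnon hPX hPeqX hPY hPeqY hσX hσ

end N3DatumRich

end Summit.Ventures.HodgeRepro2.T6
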